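import Summits.CriticalPhenomena.PercolationContinuityZ3.Theorems.PercNearOneGluingNoHeavyLowerTailSahiInterpTransform

/-!
# The interpolation leaf test for Sahi's `E_n` on `{0,1}^m`, V: masks of sub-families, `subSum`, and the static tables

Support file (cell `prim-sahi`, seat `prim-sahi-typer` gen 30; `--supports stmt-CriticalPhenomena-4575`).  Pure proofs + two auxiliary definitions
(`bitsF` — the set bits of a mask as a `Finset (Fin n)`, `maskOf` — its inverse); standard axioms, no `sorry`.

* `bitsF`/`maskOf` algebra: `testBit_maskOf`, `bitsF_maskOf`, `maskOf_bitsF`, `maskOf_insert` (`∪ {v}` = `||| 2^v`), `maskOf_sdiff` (`∖` = `^^^` with a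
  sub-mask), `maskOf_and_of_subset`, `maskOf_eq_zero_iff`, `length_bitsD`, `bitsD_cons`, `bitsD_ne_nil`;
* **`subSum_eq`** — `subSum g l acc = Σ_{C ⊆ l} g (acc ||| maskOf C)` (the sub-mask enumeration of …`SahiInterpCheck.zEntry` is the sum over the
  powerset);
* table lookups `coefTab_getD` (`k!·D^k`), `pcTab_getD` (`|bits|`), `momL_eq_sum`, `momTab_getD`, and **`maskTab_getD`** — the block bitmask
  `⋀_{i∈S} a_i` (…`SahiSymCubeMemo.andMaskF`) is `encA` of the intersection `⋂_{j ∈ bitsF S} A_j`. [this work]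
-/

namespace Summit.CriticalPhenomena.PercolationContinuityZ3.Theorems.SahiInterp

open Finset OneCutCert SahiC3Cube NCopyCert SahiSymCube

/-! ## Bit positions and masks -/

/-- The set bits of `M` below `n`. [this work] -/
def bitsF (n M : ℕ) : Finset (Fin n) := Finset.univ.filter fun j => M.testBit j

/-- The mask of a set of positions. [this work] -/
def maskOf {n : ℕ} (C : Finset (Fin n)) : ℕ := ofBits (fun t => decide (∃ j ∈ C, (j : ℕ) = t)) n

/-- Membership in `bitsF`. [this work] -/
theorem mem_bitsF {n M : ℕ} {j : Fin n} : j ∈ bitsF n M ↔ M.testBit j = true := by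
  unfold bitsF; rw [Finset.mem_filter]; simp

/-- Bits of `maskOf`. [this work] -/
theorem testBit_maskOf {n : ℕ} (C : Finset (Fin n)) (t : ℕ) : (maskOf C).testBit t = decide (∃ j ∈ C, (j : ℕ) = t) := by
  unfold maskOf
  rw [testBit_ofBits]
  by_cases ht : t < n
  · simp [ht]
  · simp only [ht, decide_false, Bool.false_and]
    symm
    rw [decide_eq_false_iff_not]
    rintro ⟨j, -, hj⟩
    exact ht (hj ▸ j.isLt)

/-- Bits of `maskOf` at positions below `n`. [this work] -/
theorem testBit_maskOf_fin {n : ℕ} (C : Finset (Fin n)) (j : Fin n) : (maskOf C).testBit j = decide (j ∈ C) := by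
  rw [testBit_maskOf]
  by_cases h : j ∈ C
  · rw [decide_eq_true h, decide_eq_true ⟨j, h, rfl⟩]
  · rw [decide_eq_false h, decide_eq_false]
    rintro ⟨j', hj', hjj⟩
    exact h (Fin.ext hjj ▸ hj')

/-- `maskOf C < 2^n`. [this work] -/
theorem maskOf_lt {n : ℕ} (C : Finset (Fin n)) : maskOf C < 2 ^ n := ofBits_lt _ _

/-- `bitsF` inverts `maskOf`. [this work] -/
theorem bitsF_maskOf {n : ℕ} (C : Finset (Fin n)) : bitsF n (maskOf C) = C := by
  ext j; rw [mem_bitsF, testBit_maskOf_fin, decide_eq_true_iff]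

/-- `maskOf` inverts `bitsF` on `M < 2^n`. [this work] -/
theorem maskOf_bitsF {n M : ℕ} (hM : M < 2 ^ n) : maskOf (bitsF n M) = M := by
  refine Nat.eq_of_testBit_eq fun t => ?_
  rw [testBit_maskOf]
  by_cases ht : t < n
  · have : (∃ j ∈ bitsF n M, (j : ℕ) = t) ↔ M.testBit t = true := by
      constructor
      · rintro ⟨j, hj, rfl⟩; exact mem_bitsF.1 hj
      · intro h; exact ⟨⟨t, ht⟩, mem_bitsF.2 h, rfl⟩
    by_cases hb : M.testBit t = true
    · rw [hb]; exact decide_eq_true (this.2 hb)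
    · rw [Bool.not_eq_true] at hb; rw [hb]; exact decide_eq_false fun h => by rw [this.1 h] at hb; exact Bool.noConfusion hb
  · rw [Nat.testBit_lt_two_pow (lt_of_lt_of_le hM (Nat.pow_le_pow_right (by norm_num) (not_lt.1 ht)))]
    exact decide_eq_false fun ⟨j, _, hj⟩ => ht (hj ▸ j.isLt)

/-- `maskOf` is injective. [this work] -/
theorem maskOf_injective {n : ℕ} {C C' : Finset (Fin n)} (h : maskOf C = maskOf C') : C = C' := by
  rw [← bitsF_maskOf C, h, bitsF_maskOf]

/-- Inserting a position sets its bit. [this work] -/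
theorem maskOf_insert {n : ℕ} (v : Fin n) (C : Finset (Fin n)) : maskOf (insert v C) = maskOf C ||| 2 ^ (v : ℕ) := by
  refine Nat.eq_of_testBit_eq fun t => ?_
  rw [Nat.testBit_or, testBit_maskOf, testBit_maskOf, Nat.testBit_two_pow]
  by_cases hv : (v : ℕ) = t
  · rw [decide_eq_true hv, Bool.or_true]; exact decide_eq_true ⟨v, Finset.mem_insert_self _ _, hv⟩
  · rw [decide_eq_false hv, Bool.or_false]
    apply Bool.eq_iff_iff.2
    simp only [decide_eq_true_eq, Finset.mem_insert]
    constructor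
    · rintro ⟨j, rfl | hj, hjt⟩
      · exact (hv hjt).elim
      · exact ⟨j, hj, hjt⟩
    · rintro ⟨j, hj, hjt⟩; exact ⟨j, Or.inr hj, hjt⟩

/-- Removing a subset clears its bits (XOR with a sub-mask). [this work] -/
theorem maskOf_sdiff {n : ℕ} {R C : Finset (Fin n)} (h : C ⊆ R) : maskOf (R \ C) = maskOf R ^^^ maskOf C := by
  refine Nat.eq_of_testBit_eq fun t => ?_
  rw [Nat.testBit_xor, testBit_maskOf, testBit_maskOf, testBit_maskOf]
  by_cases hC : ∃ j ∈ C, (j : ℕ) = t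
  · obtain ⟨j, hj, hjt⟩ := hC
    have hR : ∃ j ∈ R, (j : ℕ) = t := ⟨j, h hj, hjt⟩
    have hD : ¬ ∃ j' ∈ R \ C, (j' : ℕ) = t := by
      rintro ⟨j', hj', hj't⟩
      rw [Finset.mem_sdiff] at hj'
      exact hj'.2 (Fin.ext (hj't.trans hjt.symm) ▸ hj)
    rw [decide_eq_false hD, decide_eq_true hR, decide_eq_true ⟨j, hj, hjt⟩]; rfl
  · by_cases hR : ∃ j ∈ R, (j : ℕ) = t
    · obtain ⟨j, hj, hjt⟩ := hR
      have hD : ∃ j' ∈ R \ C, (j' : ℕ) = t := ⟨j, Finset.mem_sdiff.2 ⟨hj, fun hjC => hC ⟨j, hjC, hjt⟩⟩, hjt⟩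
      rw [decide_eq_true hD, decide_eq_true ⟨j, hj, hjt⟩, decide_eq_false hC]; rfl
    · have hD : ¬ ∃ j' ∈ R \ C, (j' : ℕ) = t := by
        rintro ⟨j', hj', hj't⟩
        exact hR ⟨j', (Finset.mem_sdiff.1 hj').1, hj't⟩
      rw [decide_eq_false hD, decide_eq_false hR, decide_eq_false hC]; rfl

/-- A subset is a sub-mask. [this work] -/
theorem maskOf_and_of_subset {n : ℕ} {R C : Finset (Fin n)} (h : C ⊆ R) : maskOf C &&& maskOf R = maskOf C := by
  refine Nat.eq_of_testBit_eq fun t => ?_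
  rw [Nat.testBit_and, testBit_maskOf, testBit_maskOf]
  by_cases hC : ∃ j ∈ C, (j : ℕ) = t
  · obtain ⟨j, hj, hjt⟩ := hC
    rw [decide_eq_true ⟨j, hj, hjt⟩, decide_eq_true ⟨j, h hj, hjt⟩]; rfl
  · rw [decide_eq_false hC]; rfl

/-- The empty mask. [this work] -/
theorem maskOf_eq_zero_iff {n : ℕ} {C : Finset (Fin n)} : maskOf C = 0 ↔ C = ∅ := by
  constructor
  · intro h
    rw [← bitsF_maskOf C, h]
    ext j; simp [mem_bitsF]
  · rintro rfl
    refine Nat.eq_of_testBit_eq fun t => ?_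
    rw [testBit_maskOf, Nat.zero_testBit]
    exact decide_eq_false fun ⟨j, hj, _⟩ => (Finset.notMem_empty j hj)

/-- The number of set bits is the card of `bitsF`. [this work] -/
theorem length_bitsD (n M : ℕ) : (bitsD n M).length = (bitsF n M).card := by
  unfold bitsD bitsF
  rw [List.length_reverse, ← List.toFinset_card_of_nodup ((List.nodup_finRange n).filter _), List.toFinset_filter,
    List.toFinset_finRange]

/-- The decreasing bit list: a set bit in front, the rest behind. [this work] -/
theorem bitsD_cons {n M : ℕ} {v : Fin n} {rest : List (Fin n)} (h : bitsD n M = v :: rest) :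
    M.testBit v = true ∧ rest.Nodup ∧ v ∉ rest ∧ rest.toFinset = (bitsF n M).erase v := by
  have hnd : (bitsD n M).Nodup := by
    unfold bitsD; rw [List.nodup_reverse]; exact (List.nodup_finRange n).filter _
  have hset : (bitsD n M).toFinset = bitsF n M := by
    unfold bitsD bitsF; rw [List.toFinset_reverse, List.toFinset_filter, List.toFinset_finRange]
  rw [h] at hnd hset
  rw [List.nodup_cons] at hnd
  refine ⟨?_, hnd.2, hnd.1, ?_⟩
  · have : v ∈ bitsF n M := by rw [← hset]; exact List.mem_toFinset.2 (List.mem_cons_self ..)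
    exact mem_bitsF.1 this
  · rw [← hset, List.toFinset_cons, Finset.erase_insert (fun hv => hnd.1 (List.mem_toFinset.1 hv))]

/-- A nonzero `M < 2^n` has a set bit below `n`. [this work] -/
theorem bitsD_ne_nil {n M : ℕ} (hM : M < 2 ^ n) (hM0 : M ≠ 0) : bitsD n M ≠ [] := by
  intro h
  have hlen := length_bitsD n M
  rw [h, List.length_nil] at hlen
  have hempty : bitsF n M = ∅ := Finset.card_eq_zero.1 hlen.symm
  apply hM0
  rw [← maskOf_bitsF hM, hempty]
  exact maskOf_eq_zero_iff.2 rfl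

/-! ## `subSum` is the sum over the sub-masks -/

/-- **`subSum g l acc = Σ_{C ⊆ l} g (acc ||| maskOf C)`** for a duplicate-free list of positions. [this work] -/
theorem subSum_eq {n : ℕ} (g : ℕ → ℤ) : ∀ (l : List (Fin n)), l.Nodup → ∀ acc : ℕ,
    subSum g l acc = ∑ C ∈ l.toFinset.powerset, g (acc ||| maskOf C)
  | [], _, acc => by
    rw [subSum, List.toFinset_nil, Finset.powerset_empty, Finset.sum_singleton, maskOf_eq_zero_iff.2 rfl, Nat.or_zero]
  | j :: l, hnd, acc => by
    rw [List.nodup_cons] at hnd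
    have hj : j ∉ l.toFinset := fun h => hnd.1 (List.mem_toFinset.1 h)
    rw [subSum, subSum_eq g l hnd.2, subSum_eq g l hnd.2, List.toFinset_cons, Finset.powerset_insert,
      Finset.sum_union (Finset.disjoint_left.2 fun C hC hC' => by
        obtain ⟨C', hC', rfl⟩ := Finset.mem_image.1 hC'
        exact hj (Finset.mem_powerset.1 hC (Finset.mem_insert_self _ _))),
      Finset.sum_image fun C hC C' hC' hCC' => by
        rw [Finset.mem_coe, Finset.mem_powerset] at hC hC'
        rw [← Finset.erase_insert (fun h => hj (hC h)), hCC', Finset.erase_insert (fun h => hj (hC' h))]]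
    congr 1
    refine Finset.sum_congr rfl fun C _ => ?_
    rw [maskOf_insert, Nat.lor_assoc, Nat.lor_comm (2 ^ (j : ℕ))]

/-! ## Reading the static tables -/

/-- Entries of `coefTab`. [this work] -/
theorem coefTab_getD {n : ℕ} (D : ℤ) {k : ℕ} (hk : k ≤ n) : (coefTab n D).getD k 0 = (k.factorial : ℤ) * D ^ k := by
  unfold coefTab; rw [getD_ofFn, dif_pos (Nat.lt_succ_of_le hk)]

/-- Entries of `pcTab`. [this work] -/
theorem pcTab_getD {n S : ℕ} (hS : S < 2 ^ n) : (pcTab n).getD S 0 = (bitsF n S).card := by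
  unfold pcTab; rw [getD_ofFn, dif_pos hS, length_bitsD]

/-- `momL` of an appended point list. [this work] -/
theorem momL_eq_sum (w : Array ℤ) (M : ℕ) : ∀ k : ℕ,
    momL w (ptsBelow M k) = ∑ y ∈ Finset.range k, (if M.testBit y then w.getD y 0 else 0)
  | 0 => by simp [momL, ptsBelow]
  | k + 1 => by
    rw [Finset.sum_range_succ, ← momL_eq_sum w M k, ptsBelow]
    by_cases h : M.testBit k = true
    · rw [if_pos h, if_pos h, momL, momL, List.foldl_append, List.foldl_cons, List.foldl_nil]
    · rw [if_neg h, if_neg h, add_zero]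

/-- Entries of `momTab`. [this work] -/
theorem momTab_getD {m n : ℕ} (maskT : Array ℕ) (w : Array ℤ) {S : ℕ} (hS : S < 2 ^ n) :
    (momTab n (ptsTab m n maskT) w).getD S 0 = ∑ y ∈ Finset.range (2 ^ m), (if (maskT.getD S 0).testBit y then w.getD y 0 else 0) := by
  unfold momTab ptsTab
  rw [getD_ofFn, dif_pos hS, getD_ofFn, dif_pos hS, momL_eq_sum]

/-- Entries of `maskTab`: the bitmask of the intersection of the selected events. [this work] -/
theorem maskTab_getD {m n : ℕ} (A : Fin n → Set (Set (Fin m))) {S : ℕ} (hS : S < 2 ^ n) :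
    (maskTab m n (List.ofFn fun i => encA m (A i))).getD S 0 = encA m (⋂ j ∈ bitsF n S, A j) := by
  classical
  unfold maskTab
  rw [getD_ofFn, dif_pos hS]
  refine Nat.eq_of_testBit_eq fun y => ?_
  rw [testBit_andMaskF, testBit_encA, List.length_ofFn]
  unfold fullN
  rw [Nat.testBit_two_pow_sub_one]
  by_cases hy : y < 2 ^ m
  · simp only [hy, decide_true, Bool.true_and, Set.mem_iInter]
    apply Bool.eq_iff_iff.2
    rw [List.all_eq_true, decide_eq_true_iff]
    constructor
    · intro h j hj
      have hi := h (j : ℕ) (List.mem_range.2 j.isLt)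
      rw [mem_bitsF] at hj
      rw [hj, Bool.not_true, Bool.false_or, List.getD_eq_getElem _ _ (by rw [List.length_ofFn]; exact j.isLt), List.getElem_ofFn,
        testBit_encA] at hi
      simp only [hy, decide_true, Bool.true_and, decide_eq_true_eq, Fin.eta] at hi
      exact hi
    · intro h i hi
      rw [List.mem_range] at hi
      by_cases hSi : S.testBit i = true
      · rw [hSi, Bool.not_true, Bool.false_or, List.getD_eq_getElem _ _ (by rw [List.length_ofFn]; exact hi), List.getElem_ofFn,
          testBit_encA]
        simp only [hy, decide_true, Bool.true_and, decide_eq_true_eq]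
        exact h ⟨i, hi⟩ (mem_bitsF.2 hSi)
      · rw [Bool.not_eq_true] at hSi; rw [hSi]; rfl
  · simp [hy]

end Summit.CriticalPhenomena.PercolationContinuityZ3.Theorems.SahiInterp
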